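import Summits.ResolutionOfSingularities.ResolutionOfSingularities.Theorems.EquisingularLiftEquisingularLiftNatSpecimenCuspConeForms
import Summits.ResolutionOfSingularities.ResolutionOfSingularities.Theorems.EquisingularLiftEquisingularLiftNatNoseTowerBTriplePrimeSpecimens
import HarnessLib

/-!
# [OURS · L1 W4.5(b) · EL♮(3)] NOSE ENGINE CERTIFICATION ‖ K, specimen 2 — the CUSPIDAL CUBIC CONE `x₀x₂² = x₃³`: every blow-up of `H` along the
# double line is regular, and `ReachNoseTowerBTriplePrime` HOLDS for `H` (file 3/3; every field, every characteristic)

Cell `res-hironaka`, slot W4.5(b); crux **EL♮(3)** (stmt-ResolutionOfSingularities-20148; parent EL♮ stmt-…-20038), line `sections`, CHILD skeleton v40;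
width seat res-L1-w45b-nose-w3, row «NOSE ENGINE CERT ‖ K» of res-L1-w45b-plan-1's WIDTH TABLE D1′. `--supports stmt-ResolutionOfSingularities-20148 --as helper`;
closes nothing. OURS; NOT a statement of any manuscript; AI-written, weaker than expert review. One small `def` (`gen`, as in R2), no `sorry`, standard
axioms. HONESTY: resolution of surfaces in positive characteristic is a theorem in print (CP 2008/2009); this is OUR kernel bookkeeping, counted 0.
Pattern: res-D-pv-022's `…NatSpecimenWhitneyCubicCharts` (R2) VERBATIM where possible (its form-free lemmas `WhitneyCubic.X_mem_of_mem_support`,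
`exists_mem_basicOpen`, `isBlowup_of_ideal_eq` and res-D-pv-013's kill-map lemmas for `Σ = V(x₂, x₃)` are reused by name).

`H = V₊(x₀x₂² − x₃³) ⊂ ℙ³_k`: the cone over the cuspidal cubic, singular along the DOUBLE LINE `Σ = V(x₂, x₃) = V(Λ)`, `Λ = ker Proj(f_k)` (kill map,
`r = 1`, `m = 2`), transversal type `A₂`, a point of multiplicity `3` at the vertex `[0:1:0:0] ∈ Σ` — so `Σ` is NOT an equimultiple centre; the chain's
game only asks for a class₂ curve inside `ι(H)` and a regular END, and ONE blow-up along `Σ` delivers it: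

* `support_subset_range`, `not_range_subset_support` — `V(Λ) ⊆ ι(H)` (`F ∈ (x₂, x₃)`), `ι(H) ⊄ V(Λ)` (`x₂ ∉ (F)`);
* `comap_chart_eq_ofIdealTop` — on `Spec (ChartRing F c)` the centre `Λ·𝒪_H` is `(x₂/x_c, x₃/x_c)~`;
* **`isRegular_of_isBlowup_comap`** — EVERY blow-up of `H` along `Λ·𝒪_H` is a regular scheme (charts `c = 2, 3`: unit centre, regular chart ring;
  `c = 0, 1`: the generator charts are spectra of the regular rings of `…NatSpecimenCuspConeForms.isRegularRing_blowupAlgebra_gen`);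
* `doubleLine_subset_range_ι`, `not_range_ι_subset_doubleLine` — the same incidences in the set currency of the certificate;
* ★ **`reachNoseTowerBTriplePrime_cuspCone`** — `ReachNoseTowerBTriplePrime K 3 H ι` by the ZERO-ROUND CERTIFICATE SCHEMA `reachNoseTowerBTriplePrime_of_oneBlowup`
  (p642717): `Z = Σ` class₂ (`base ∘ SkewLines.line_isLiftableNoseClass`), infinite and a curve (`WhitneyCubic.doubleLine_infinite/curve`, p642717), the
  blow-up of `𝓘⟨Σ⟩ = Λ` and the regular reduced strict transform (`LinearCentre.isRegular_reducedStrictTransform_of_blowupModel` over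
  `isRegular_of_isBlowup_comap`). SECOND kernel inhabitant of the B‴ nose predicate, of a different transversal type (`A₂` + a triple vertex) than R2
  (`A₁` + Whitney pinches). Census class: v6 CI-nose (like R2) — a certification specimen, not a residue-class nose.

References: The Stacks Project 0804; Liu 2002 Thm 8.1.19; Görtz–Wedhorn Prop. 13.96; Hartshorne II Prop. 5.9 — through the cited tree files.
-/

set_option linter.dupNamespace false -- mandated namespace `Summit.<Summit>.<Problem>` of this single-conjunct summit

noncomputable section

open CategoryTheory CategoryTheory.Limits AlgebraicGeometry TopologicalSpace
open MvPolynomial HomogeneousLocalization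
open Literature.AlgebraicGeometry.Resolution
open Literature.AlgebraicGeometry.Motives Literature.AlgebraicGeometry.Motives.SmoothHypersurface
open Literature.AlgebraicGeometry.Motives.ProjectiveSpace
open AlgebraicGeometry.Scheme.IdealSheafData
open Summit.ResolutionOfSingularities.ResolutionOfSingularities.Cruxes.EquisingularLift.StrataSplit

namespace Summit.ResolutionOfSingularities.ResolutionOfSingularities.Cruxes.EquisingularLiftNat.Sections

namespace CuspCone

variable (k : Type) [Field k]

attribute [local instance] MvPolynomial.gradedAlgebra ProjBaseChange.algebraBase

/-! ## The kill-map centre `Λ = V₊(x₂, x₃)` and the hypersurface -/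

section Kill

variable (fk : homogeneousSubmodule (Fin (1 + 2 + 1)) k →+*ᵍ homogeneousSubmodule (Fin (1 + 1)) k)
  (hfk' : HomogeneousIdeal.irrelevant (homogeneousSubmodule (Fin (1 + 1)) k) ≤
    (HomogeneousIdeal.irrelevant (homogeneousSubmodule (Fin (1 + 2 + 1)) k)).map fk) (hfkC : ∀ a : k, fk (C a) = C a)
  (hfkX : ∀ i : Fin (1 + 2 + 1), fk (X i) = if h : (i : ℕ) < 1 + 1 then X ⟨i, h⟩ else 0)

include hfkC hfkX in
/-- **`V(Λ) ⊆ V₊(F) = ι(H)`** (`F = x₀x₂² − x₃³ ∈ (x₂, x₃)`). [folklore] -/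
theorem support_subset_range :
    ((Proj.map fk hfk').ker.support : Set (Proj (homogeneousSubmodule (Fin (1 + 2 + 1)) k))) ⊆
      Set.range (hypersurfaceι (CuspCone.form k)).left := by
  intro x hx
  have h2 := WhitneyCubic.X_mem_of_mem_support k fk hfk' hfkC hfkX hx 2 (by decide)
  have h3 := WhitneyCubic.X_mem_of_mem_support k fk hfk' hfkC hfkX hx 3 (by decide)
  refine (Set.ext_iff.mp (range_hypersurfaceι (CuspCone.form k)) x).mpr
    ((ProjectiveSpectrum.mem_zeroLocus _ _ _).mpr (Set.singleton_subset_iff.mpr ?_))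
  change form k ∈ x.asHomogeneousIdeal
  rw [CuspCone.form]
  exact Ideal.sub_mem _ (Ideal.mul_mem_left _ _ (Ideal.pow_mem_of_mem _ h2 2 two_pos)) (Ideal.pow_mem_of_mem _ h3 3 three_pos)

include hfkC hfkX in
/-- **`ι(H) ⊄ V(Λ)`**: the generic point `(F)` of `H` lies in `D₊(x₂)`. [folklore] -/
theorem not_range_subset_support :
    ¬ (Set.range (hypersurfaceι (CuspCone.form k)).left ⊆
      ((Proj.map fk hfk').ker.support : Set (Proj (homogeneousSubmodule (Fin (1 + 2 + 1)) k)))) := by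
  intro h
  have hmem : (pointOfPrime (CuspCone.form k) (isHomogeneous_form k) (prime_form k) :
      Proj (homogeneousSubmodule (Fin (1 + 2 + 1)) k)) ∈ Set.range (hypersurfaceι (CuspCone.form k)).left := by
    refine (Set.ext_iff.mp (range_hypersurfaceι (CuspCone.form k)) _).mpr
      ((ProjectiveSpectrum.mem_zeroLocus _ _ _).mpr (Set.singleton_subset_iff.mpr ?_))
    exact Ideal.subset_span rfl
  have h2 := WhitneyCubic.X_mem_of_mem_support k fk hfk' hfkC hfkX (h hmem) 2 (by decide)
  exact X_two_not_mem_span_form k h2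

end Kill

/-! ## The centre on the chart `Spec (ChartRing F c) → ℙ³_k` -/

section Chart

variable (fk : homogeneousSubmodule (Fin (1 + 2 + 1)) k →+*ᵍ homogeneousSubmodule (Fin (1 + 1)) k)
  (hfk' : HomogeneousIdeal.irrelevant (homogeneousSubmodule (Fin (1 + 1)) k) ≤
    (HomogeneousIdeal.irrelevant (homogeneousSubmodule (Fin (1 + 2 + 1)) k)).map fk) (hfkC : ∀ a : k, fk (C a) = C a)
  (hfkX : ∀ i : Fin (1 + 2 + 1), fk (X i) = if h : (i : ℕ) < 1 + 1 then X ⟨i, h⟩ else 0)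
  (c : Fin 4)

/-- `Spec (ChartRing F c) → H ↪ ℙ³_k` is `Spec (k[x]_{(x_c)} → ChartRing F c)` followed by `D₊(x_c) ↪ ℙ³_k`. [folklore] -/
theorem chart_left_comp_ι :
    (chart (CuspCone.form k) c (isHomogeneous_form k) three_pos).left ≫ (hypersurfaceι (CuspCone.form k)).left =
      Spec.map (CommRingCat.ofHom (toChartRing (CuspCone.form k) c (isHomogeneous_form k)).toRingHom) ≫
        Proj.awayι (homogeneousSubmodule (Fin (2 + 1 + 1)) k) (X c) (X_mem c) one_pos := by
  have h := congrArg (fun f => f.left) (chart_hypersurfaceι (CuspCone.form k) c (isHomogeneous_form k) three_pos)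
  simp only [Over.comp_left, specOverOfAlgHom_left, awayChartι_left] at h
  exact h

/-- **Pulling a section `b` of `D₊(x_c)` back to `Spec (ChartRing F c)`** gives `[b]` (through `Γ(Spec A, ⊤) ≅ A`). [folklore] -/
theorem appLE_chart_awayToSection
    (hle : (⊤ : (Spec (CommRingCat.of (ChartRing (CuspCone.form k) c (isHomogeneous_form k)))).Opens) ≤
      (Spec.map (CommRingCat.ofHom (toChartRing (CuspCone.form k) c (isHomogeneous_form k)).toRingHom) ≫
        Proj.awayι (homogeneousSubmodule (Fin (2 + 1 + 1)) k) (X c) (X_mem c) one_pos) ⁻¹ᵁ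
          Proj.basicOpen (homogeneousSubmodule (Fin (2 + 1 + 1)) k) (X c))
    (b : Away (homogeneousSubmodule (Fin (2 + 1 + 1)) k) (X c)) :
    ((Spec.map (CommRingCat.ofHom (toChartRing (CuspCone.form k) c (isHomogeneous_form k)).toRingHom) ≫
        Proj.awayι (homogeneousSubmodule (Fin (2 + 1 + 1)) k) (X c) (X_mem c) one_pos).appLE
        (Proj.basicOpen (homogeneousSubmodule (Fin (2 + 1 + 1)) k) (X c)) ⊤ hle).hom
        ((Proj.awayToSection (homogeneousSubmodule (Fin (2 + 1 + 1)) k) (X c)).hom b) =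
      (Scheme.ΓSpecIso (CommRingCat.of (ChartRing (CuspCone.form k) c (isHomogeneous_form k)))).inv.hom
        (toChartRing (CuspCone.form k) c (isHomogeneous_form k) b) := by
  have happ : (Spec.map (CommRingCat.ofHom (toChartRing (CuspCone.form k) c (isHomogeneous_form k)).toRingHom) ≫
        Proj.awayι (homogeneousSubmodule (Fin (2 + 1 + 1)) k) (X c) (X_mem c) one_pos).appLE
        (Proj.basicOpen (homogeneousSubmodule (Fin (2 + 1 + 1)) k) (X c)) ⊤ hle =
      (Proj.awayι (homogeneousSubmodule (Fin (2 + 1 + 1)) k) (X c) (X_mem c) one_pos).appLE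
          (Proj.basicOpen (homogeneousSubmodule (Fin (2 + 1 + 1)) k) (X c)) ⊤
          (ProjFrac.awayι_preimage_basicOpen_self (X_mem (R := k) c) one_pos).ge ≫
        (Spec.map (CommRingCat.ofHom (toChartRing (CuspCone.form k) c (isHomogeneous_form k)).toRingHom)).appLE ⊤ ⊤ le_rfl :=
    (Scheme.Hom.appLE_comp_appLE _ _ _ _ _ _ _).symm
  have htop : (Spec.map (CommRingCat.ofHom (toChartRing (CuspCone.form k) c (isHomogeneous_form k)).toRingHom)).appLE ⊤ ⊤ le_rfl =
      (Spec.map (CommRingCat.ofHom (toChartRing (CuspCone.form k) c (isHomogeneous_form k)).toRingHom)).appTop :=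
    (Scheme.Hom.app_eq_appLE _).symm
  rw [happ, ProjFrac.appLE_awayι_eq_resAway, htop, CategoryTheory.ConcreteCategory.comp_apply,
    ProjFrac.resAway_awayToSection]
  have hnat := Scheme.ΓSpecIso_inv_naturality
    (CommRingCat.ofHom (toChartRing (CuspCone.form k) c (isHomogeneous_form k)).toRingHom)
  exact (congrArg (fun f => f.hom b) hnat).symm

/-- The generators `x_{c'}/x_c`, `c' ≥ 2`, of the centre, read in `ChartRing F c`. [folklore] -/
def gen : {c' : Fin (1 + 2 + 1) // 1 + 1 ≤ (c' : ℕ)} → ChartRing (CuspCone.form k) c (isHomogeneous_form k) :=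
  fun c' => tautVec (CuspCone.form k) c (isHomogeneous_form k) c'.1

/-- The generators are `x₂/x_c` and `x₃/x_c`. [folklore] -/
theorem range_gen : Set.range (gen k c) =
    {tautVec (CuspCone.form k) c (isHomogeneous_form k) 2, tautVec (CuspCone.form k) c (isHomogeneous_form k) 3} := by
  ext t
  constructor
  · rintro ⟨⟨c', hc'⟩, rfl⟩
    have h : c' = 2 ∨ c' = 3 := by
      fin_cases c' <;> simp at hc' ⊢
    rcases h with rfl | rfl
    · exact Or.inl rfl
    · exact Or.inr rfl
  · rintro (rfl | rfl)
    · exact ⟨⟨2, by decide⟩, rfl⟩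
    · exact ⟨⟨3, by decide⟩, rfl⟩

include hfkC hfkX in
/-- **THE CENTRE ON THE CHART**: the pull-back of `Λ = ker Proj(f_k)` along `Spec (ChartRing F c) → H ↪ ℙ³_k` is the ideal sheaf of
`(x₂/x_c, x₃/x_c) ⊆ ChartRing F c`. [folklore] -/
theorem comap_chart_eq_ofIdealTop :
    (((Proj.map fk hfk').ker.comap (hypersurfaceι (CuspCone.form k)).left).comap
        (chart (CuspCone.form k) c (isHomogeneous_form k) three_pos).left :
        (Spec (CommRingCat.of (ChartRing (CuspCone.form k) c (isHomogeneous_form k)))).IdealSheafData) =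
      ofIdealTop ((Ideal.span (Set.range (gen k c))).map
        (Scheme.ΓSpecIso (CommRingCat.of (ChartRing (CuspCone.form k) c (isHomogeneous_form k)))).inv.hom) := by
  haveI : IsAffine (Comma.left (specOver k (ChartRing (CuspCone.form k) c (isHomogeneous_form k)))) :=
    inferInstanceAs (IsAffine (Spec (CommRingCat.of (ChartRing (CuspCone.form k) c (isHomogeneous_form k)))))
  set π := Spec.map (CommRingCat.ofHom (toChartRing (CuspCone.form k) c (isHomogeneous_form k)).toRingHom) ≫
    Proj.awayι (homogeneousSubmodule (Fin (2 + 1 + 1)) k) (X c) (X_mem c) one_pos with hπ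
  have hcomp : ((Proj.map fk hfk').ker.comap (hypersurfaceι (CuspCone.form k)).left).comap
      (chart (CuspCone.form k) c (isHomogeneous_form k) three_pos).left = (Proj.map fk hfk').ker.comap π := by
    rw [← Scheme.IdealSheafData.comap_comp]
    exact congrArg (fun f => (Proj.map fk hfk').ker.comap f) (chart_left_comp_ι k c)
  refine hcomp.trans ?_
  let D : (Proj (homogeneousSubmodule (Fin (1 + 2 + 1)) k)).affineOpens :=
    ⟨Proj.basicOpen (homogeneousSubmodule (Fin (1 + 2 + 1)) k) (X c),
      Proj.isAffineOpen_basicOpen _ (X c) (LinearCentre.X_mem_one (r := 1) (m := 2) c) one_pos⟩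
  have hV : ((⟨⊤, isAffineOpen_top _⟩ : (Spec (CommRingCat.of (ChartRing (CuspCone.form k) c (isHomogeneous_form k)))).affineOpens) :
      (Spec (CommRingCat.of (ChartRing (CuspCone.form k) c (isHomogeneous_form k)))).Opens) = π ⁻¹ᵁ (D : (Proj _).Opens) := by
    change ⊤ = Spec.map _ ⁻¹ᵁ (Proj.awayι (homogeneousSubmodule (Fin (2 + 1 + 1)) k) (X c) (X_mem c) one_pos ⁻¹ᵁ
      Proj.basicOpen (homogeneousSubmodule (Fin (2 + 1 + 1)) k) (X c))
    rw [ProjFrac.awayι_preimage_basicOpen_self (X_mem (R := k) c) one_pos]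
    rfl
  apply Scheme.IdealSheafData.ext_of_isAffine
  rw [ideal_ofIdealTop_top, Literature.AlgebraicGeometry.Limits.ideal_comap_eq_map π _ D _ hV,
    LinearCentre.ker_projMap_kill_ideal_basicOpen fk hfk' hfkC hfkX c, Ideal.map_span, Ideal.map_span,
    ← Set.range_comp, ← Set.range_comp]
  refine congrArg Ideal.span (congrArg Set.range (funext fun c' => ?_))
  simp only [Function.comp_apply]
  rw [appLE_chart_awayToSection]
  rfl

end Chart

/-! ## Every blow-up of `H` along `Λ · 𝒪_H` is regular -/

section Down

variable (fk : homogeneousSubmodule (Fin (1 + 2 + 1)) k →+*ᵍ homogeneousSubmodule (Fin (1 + 1)) k)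
  (hfk' : HomogeneousIdeal.irrelevant (homogeneousSubmodule (Fin (1 + 1)) k) ≤
    (HomogeneousIdeal.irrelevant (homogeneousSubmodule (Fin (1 + 2 + 1)) k)).map fk) (hfkC : ∀ a : k, fk (C a) = C a)
  (hfkX : ∀ i : Fin (1 + 2 + 1), fk (X i) = if h : (i : ℕ) < 1 + 1 then X ⟨i, h⟩ else 0)

include hfkC hfkX in
/-- **`Bl_Σ H` IS REGULAR, for every blow-up**: every blow-up `ρ : Z → H` of the cuspidal cubic cone along the trace `Λ · 𝒪_H` of the linear centre
`Λ = V₊(x₂, x₃)` is a regular scheme. Over `D₊(x_c)` it is a blow-up of `Spec (ChartRing F c)` along `(x₂/x_c, x₃/x_c)~` (`comap_chart_eq_ofIdealTop`);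
for `c ≥ 2` that ideal is `(1)` and the blow-up is an isomorphism onto the regular `Spec (ChartRing F c)`; for `c ≤ 1` the charts at the generators
(Stacks 0804) are spectra of regular rings (`isRegularRing_blowupAlgebra_gen`). R2's proof, verbatim. [folklore; Stacks 0804, Liu 8.1.19, GW 13.96] -/
theorem isRegular_of_isBlowup_comap (Z : Scheme.{0}) (ρ : Z ⟶ (hypersurface (CuspCone.form k)).left)
    (hρ : IsBlowup ρ (((Proj.map fk hfk').ker.comap (hypersurfaceι (CuspCone.form k)).left))) : Scheme.IsRegular Z := by
  intro z
  obtain ⟨c, hc⟩ := WhitneyCubic.exists_mem_basicOpen k ((hypersurfaceι (CuspCone.form k)).left (ρ z))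
  let U : (hypersurface (CuspCone.form k)).left.Opens :=
    (hypersurfaceι (CuspCone.form k)).left ⁻¹ᵁ Proj.basicOpen (homogeneousSubmodule (Fin (2 + 1 + 1)) k) (X c)
  have hzU : ρ z ∈ U := hc
  have hrange : Set.range (chart (CuspCone.form k) c (isHomogeneous_form k) three_pos).left = Set.range U.ι := by
    rw [range_chart_left, Scheme.Opens.range_ι]
  let e := IsOpenImmersion.isoOfRangeEq (chart (CuspCone.form k) c (isHomogeneous_form k) three_pos).left U.ι hrange
  have he : e.hom ≫ U.ι = (chart (CuspCone.form k) c (isHomogeneous_form k) three_pos).left :=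
    IsOpenImmersion.isoOfRangeEq_hom_fac _ _ _
  -- the restricted blow-up, moved to `Spec (ChartRing F c)`
  have hρU : IsBlowup ((ρ ∣_ U) ≫ e.symm.hom) (ofIdealTop ((Ideal.span (Set.range (gen k c))).map
      (Scheme.ΓSpecIso (CommRingCat.of (ChartRing (CuspCone.form k) c (isHomogeneous_form k)))).inv.hom)) := by
    have h := (hρ.restrict U).comp_iso e.symm
    rw [← Scheme.IdealSheafData.comap_comp, Iso.symm_inv, he] at h
    exact WhitneyCubic.isBlowup_of_ideal_eq h (comap_chart_eq_ofIdealTop k fk hfk' hfkC hfkX c)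
  -- the stalk of `Z` at `z` is the stalk of the open piece `ρ⁻¹ U` at `⟨z, _⟩`
  haveI : IsIso ((ρ ⁻¹ᵁ U).ι.stalkMap ⟨z, hzU⟩) := inferInstance
  suffices hst : IsRegularLocalRing ((↑(ρ ⁻¹ᵁ U) : Scheme.{0}).presheaf.stalk ⟨z, hzU⟩) from by
    haveI := hst
    exact IsRegularLocalRing.of_ringEquiv (asIso ((ρ ⁻¹ᵁ U).ι.stalkMap ⟨z, hzU⟩)).commRingCatIsoToRingEquiv.symm
  by_cases hc2 : 1 + 1 ≤ (c : ℕ)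
  · -- `c = 2, 3`: the centre is the unit ideal, the blow-up is an isomorphism onto the regular `Spec (ChartRing F c)`
    have htop : Ideal.span (Set.range (gen k c)) = ⊤ :=
      Ideal.eq_top_of_isUnit_mem _ (Ideal.subset_span ⟨⟨c, hc2⟩, rfl⟩)
        (by rw [show gen k c ⟨c, hc2⟩ = tautVec (CuspCone.form k) c (isHomogeneous_form k) c from rfl, tautVec_self]
            exact isUnit_one)
    have hI : ofIdealTop ((Ideal.span (Set.range (gen k c))).map
        (Scheme.ΓSpecIso (CommRingCat.of (ChartRing (CuspCone.form k) c (isHomogeneous_form k)))).inv.hom) = ⊤ := by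
      rw [htop, Ideal.map_top]
      exact Scheme.IdealSheafData.ext_of_isAffine (by rw [ideal_ofIdealTop_top]; rfl)
    have hρU' : IsBlowup ((ρ ∣_ U) ≫ e.symm.hom)
        (⊤ : (Spec (CommRingCat.of (ChartRing (CuspCone.form k) c (isHomogeneous_form k)))).IdealSheafData) := by
      rw [← hI]
      exact hρU
    haveI : IsIso ((ρ ∣_ U) ≫ e.symm.hom) := hρU'.isIso isEffectiveCartier_top
    haveI : IsRegularRing (ChartRing (CuspCone.form k) c (isHomogeneous_form k)) := isRegularRing_chartRing_of_two_le k c hc2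
    haveI : IsRegularLocalRing ((Spec (CommRingCat.of (ChartRing (CuspCone.form k) c (isHomogeneous_form k)))).presheaf.stalk
        (((ρ ∣_ U) ≫ e.symm.hom) ⟨z, hzU⟩)) :=
      Scheme.isRegular_Spec (CommRingCat.of (ChartRing (CuspCone.form k) c (isHomogeneous_form k))) (((ρ ∣_ U) ≫ e.symm.hom) ⟨z, hzU⟩)
    exact IsRegularLocalRing.of_ringEquiv
      (R := (Spec (CommRingCat.of (ChartRing (CuspCone.form k) c (isHomogeneous_form k)))).presheaf.stalk (((ρ ∣_ U) ≫ e.symm.hom) ⟨z, hzU⟩))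
      (asIso (((ρ ∣_ U) ≫ e.symm.hom).stalkMap ⟨z, hzU⟩)).commRingCatIsoToRingEquiv
  · -- `c = 0, 1`: the charts at the generators are spectra of regular rings
    have hc' : (c : ℕ) < 2 := by omega
    obtain ⟨j, φ, hφ, hzφ, -⟩ := IsBlowup.exists_chart_of_span_range_eq hρU (gen k c) rfl ⟨z, hzU⟩
    obtain ⟨w, hw⟩ := hzφ
    have hreg : IsRegularRing (blowupAlgebra (Ideal.span (Set.range (gen k c))) (gen k c j)) := by
      rw [range_gen]
      exact isRegularRing_blowupAlgebra_gen k c hc' j.1 j.2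
    haveI := hreg
    by_contra hz
    rw [← hw] at hz
    exact not_isRegularLocalRing_localization_of_stalk φ w hz inferInstance

end Down

/-! ## The certificate: `ReachNoseTowerBTriplePrime` holds for the cuspidal cubic cone -/

/-- `Σ ⊆ ι(H)` in the set currency: `F = x₀x₂² − x₃³ ∈ 𝔭_y` whenever `x₂, x₃ ∈ 𝔭_y`. [folklore] -/
theorem doubleLine_subset_range_ι :
    {y : (Literature.AlgebraicGeometry.Motives.projectiveSpace 3 k).left |
      ∀ i, (![X 2, X 3] : Fin 2 → MvPolynomial (Fin (3 + 1)) k) i ∈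
        (y : ProjectiveSpectrum (MvPolynomial.homogeneousSubmodule (Fin (3 + 1)) k)).asHomogeneousIdeal} ⊆
      Set.range (hypersurfaceι (CuspCone.form k)).left := by
  intro y hy
  have h2 : (X 2 : MvPolynomial (Fin (3 + 1)) k) ∈ y.asHomogeneousIdeal := hy 0
  have h3 : (X 3 : MvPolynomial (Fin (3 + 1)) k) ∈ y.asHomogeneousIdeal := hy 1
  refine (Set.ext_iff.mp (range_hypersurfaceι (CuspCone.form k)) y).mpr
    ((ProjectiveSpectrum.mem_zeroLocus _ _ _).mpr (Set.singleton_subset_iff.mpr ?_))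
  change form k ∈ y.asHomogeneousIdeal
  rw [CuspCone.form]
  exact Ideal.sub_mem _ (Ideal.mul_mem_left _ _ (Ideal.pow_mem_of_mem _ h2 2 two_pos)) (Ideal.pow_mem_of_mem _ h3 3 three_pos)

/-- `ι(H) ⊄ Σ`: the generic point `(F)` of `H` does not contain `x₂`. [folklore] -/
theorem not_range_ι_subset_doubleLine :
    ¬ (Set.range (hypersurfaceι (CuspCone.form k)).left ⊆
      {y : (Literature.AlgebraicGeometry.Motives.projectiveSpace 3 k).left |
      ∀ i, (![X 2, X 3] : Fin 2 → MvPolynomial (Fin (3 + 1)) k) i ∈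
        (y : ProjectiveSpectrum (MvPolynomial.homogeneousSubmodule (Fin (3 + 1)) k)).asHomogeneousIdeal}) := by
  intro h
  have hmem : (pointOfPrime (CuspCone.form k) (isHomogeneous_form k) (prime_form k) :
      Proj (homogeneousSubmodule (Fin (3 + 1)) k)) ∈ Set.range (hypersurfaceι (CuspCone.form k)).left := by
    refine (Set.ext_iff.mp (range_hypersurfaceι (CuspCone.form k)) _).mpr
      ((ProjectiveSpectrum.mem_zeroLocus _ _ _).mpr (Set.singleton_subset_iff.mpr ?_))
    exact Ideal.subset_span rfl
  have h2 : (X 2 : MvPolynomial (Fin 4) k) ∈ Ideal.span {CuspCone.form k} := (h hmem) 0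
  exact X_two_not_mem_span_form k h2

/-- **THE B‴ NOSE PREDICATE HOLDS FOR THE CUSPIDAL CUBIC CONE** `H = V₊(x₀x₂² − x₃³) ⊂ ℙ³_K` (ANY field `K`, every characteristic incl. `2, 3`):
`ReachNoseTowerBTriplePrime K 3 H ι` with the nose `Z = Σ = V(x₂, x₃)` (the double line through the triple vertex), ONE blow-up of `𝓘⟨Σ⟩ = ker Proj(f_K)`
and an EMPTY round phase, by the zero-round certificate schema `reachNoseTowerBTriplePrime_of_oneBlowup` (p642717): class₂ by
`base ∘ SkewLines.line_isLiftableNoseClass`, `Σ ⊆ ι(H) ⊄ Σ`, infinite and a curve (`WhitneyCubic.doubleLine_infinite/curve`), and the regular reduced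
strict transform (`LinearCentre.isRegular_reducedStrictTransform_of_blowupModel` over `isRegular_of_isBlowup_comap`). Second kernel inhabitant of the chain's
nose predicate; transversal type `A₂` with a non-equimultiple point on the nose. [OURS · L1 W4.5b] -/
theorem reachNoseTowerBTriplePrime_cuspCone (K : Type) [Field K] :
    ReachNoseTowerBTriplePrime K 3 (hypersurface (CuspCone.form K)).left (hypersurfaceι (CuspCone.form K)).left := by
  classical
  obtain ⟨fk, hfk', hfkC, hfkX⟩ := EquisingularLift.StrataSplit.LinearCentre.exists_kill K 1 2
  haveI := isIntegral_hypersurface K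
  haveI : IsLocallyNoetherian (Literature.AlgebraicGeometry.Motives.projectiveSpace (2 + 1) K).left :=
    EquisingularLift.StrataSplit.LinearCentre.isLocallyNoetherian_proj K (1 + 2)
  -- a blow-up of `ℙ³_K` along `Λ = ker Proj(f_K) = 𝓘(Σ)`
  obtain ⟨F₂, υ, hυ⟩ := exists_isBlowup (Proj (homogeneousSubmodule (Fin (1 + 2 + 1)) K)) (Proj.map fk hfk').ker
  have hΛ := WhitneyCubic.ker_projMap_kill_eq_vanishingIdeal_doubleLine K fk hfk' hfkC hfkX (WhitneyCubic.isClosed_doubleLine K)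
  have hsupp := WhitneyCubic.support_ker_projMap_kill_eq_doubleLine K fk hfk' hfkC hfkX
  -- the reduced strict transform is regular
  have hreg : Scheme.IsRegular (vanishingIdeal (⟨closure (υ ⁻¹' (Set.range (hypersurfaceι (CuspCone.form K)).left \
      ((Proj.map fk hfk').ker.support : Set (Proj (homogeneousSubmodule (Fin (1 + 2 + 1)) K))))), isClosed_closure⟩ :
      Closeds F₂)).subscheme :=
    EquisingularLift.StrataSplit.LinearCentre.isRegular_reducedStrictTransform_of_blowupModel (hypersurfaceι (CuspCone.form K)).left
      (Proj.map fk hfk').ker (not_range_subset_support K fk hfk' hfkC hfkX)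
      (fun Z ρ hρ => isRegular_of_isBlowup_comap K fk hfk' hfkC hfkX Z ρ hρ) υ hυ
  rw [hsupp] at hreg
  rw [hΛ] at hυ
  exact reachNoseTowerBTriplePrime_of_oneBlowup K 3 _ (hypersurfaceι (CuspCone.form K)).left _ (WhitneyCubic.isClosed_doubleLine K)
    (IsLiftableNoseClass₂.base _ (SkewLines.line_isLiftableNoseClass K 2 3 0 (by decide) (by decide) (by decide)))
    (doubleLine_subset_range_ι K) (not_range_ι_subset_doubleLine K) (WhitneyCubic.doubleLine_infinite K)
    (WhitneyCubic.doubleLine_curve K) F₂ υ hυ hreg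

end CuspCone

end Summit.ResolutionOfSingularities.ResolutionOfSingularities.Cruxes.EquisingularLiftNat.Sections

end
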